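import Summits.QuantumFields.BalabanUV.Beta.D1BFx.PointColumnDecay
import Summits.QuantumFields.BalabanUV.Beta.D1BFx.GhostLeg
import Literature.MathematicalPhysics.QuantumFieldTheory.Balaban1983to89.Beta.GhostTable
import Literature.MathematicalPhysics.QuantumFieldTheory.Balaban1983to89.Beta.BubbleTransfer

/-!
# `BalabanUV.Beta.D1BFx.GhostLegFree` — road «BF-x» for binder row D1, sub-leaf **L2-gh** (part 3 of 3):
# FOUR OF THE SIX SCALAR LEG ROWS FOR THE GHOST LEG `Ggh` (T2), HYPOTHESIS-FREE, IN THE WALL'S ATOMS: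
# `h0` `|n²·Ggh n a (b+v) b − gFree v| ≤ D₀/n²`, `h1` (first differences, `D₁/n³`), `d0` `|n²·Ggh n a (b+v) b| ≤ A₀e^{−(δ/n)|v|_∞}/|v|_∞²`,
# `d1` (first differences, `A₁e^{−(δ/n)|v|_∞}/|v|_∞³`) — uniformly in the block size `n ≥ 1` and the base point `b`

HONEST FRAMING (cell contract, verbatim): «discharging `BetaPertH` makes Bałaban's UV stability UNCONDITIONAL — a real constructive-QFT
result; it is NOT the continuum limit and NOT the Clay problem.»  HONEST DEPENDENCY (verbatim): «continuum YM on T⁴ ⇐ BetaPertH ∧ nine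
spine estimates (0/9 proved); BetaPertH ⇐ (D1) ∧ (D4) ∧ CAP+tail; G-an2-4 gates asym, D1 and NE2/3/4.»  THIS MODULE DISCHARGES NOTHING of
that: it packages parts 1–2 (`PointColumnSplit`, `PointColumnDual`, `PointColumnDecay`) at `d = 4` in the currency of
`SquareTable.oneLoopDrift_of_scalarBounds_avg` / A2′ `GhostRelegging.abs_fullSum_stKI_sub_le` (rows `h0 h1 d0 d1` of ONE leg family of ONE road to
ONE conjunct (D1)).  0 wall binders instantiated; rows `h2/d2` are NOT here (see HONEST SCOPE); NOT A2′/A1.ii, NOT D1, NOT BetaPertH, NOT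
continuum, NOT Clay.
ABSOLUTE RULE (cell, verbatim): «No internally-minted statement may enter as a cited fact. Every hypothesis is either kernel-proved in this
package or a verbatim quotation of a PUBLISHED theorem with page reference.»  Nothing printed is asserted or cited; the only inputs are the
tree modules named below; three constants with bodies (`cG1`, `ghA0`, `ghA1`) and one rate (`ghDelta`), no `def … : Prop`.

THE ROWS (T2's `GhostLeg.Ggh n a x y () () = Gk (n−1) a x y`, block side `n`; `Gf n b v := n²·Ggh n a (b+v) b`; `gFree = G₀`, `unitVec = e`, and the two
`supNorm`s agree, all by `rfl`): for every `n ≥ 1`, `a > 0`, `b` — **`ghost_h0`** `|n²·Ggh (b+v) b − gFree v| ≤ cSplit(4,a)/n²`; **`ghost_h1`** first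
differences `≤ cSplit(4,a)/n³`; **`ghost_d0`** `v ≠ 0 ⇒ |n²·Ggh (b+v) b| ≤ ghA0·e^{−(ghDelta/n)|v|_∞}/|v|_∞²`; **`ghost_d1`** first differences
`≤ ghA1·e^{−(ghDelta/n)|v|_∞}/|v|_∞³` (NEAR field `|v|_∞ < 8n`: h0/h1 + the free-leg envelopes `cG0/|v|²`, `cG1/|v|³`; FAR field: part 2b at block
separation `8k ≤ K₀`, `K₀` the block offset along the coordinate achieving `|v|_∞`, `|v|_∞ ≤ 16kn`, `k^j e^{−4δ_u k} ≤ (2/δ_u)^j e^{−δ_u k}`); packaged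
as **`ghLeg_rows`** for `ghLeg n a b := fun v => n²·Ggh n a (b+v) b` — LITERALLY the `h0/h1/d0/d1` binders of A2′ `GhostRelegging.abs_fullSum_stKI_sub_le`
/ `SquareTable.oneLoopDrift_of_scalarBounds_avg` with `D 0 = D 1 := cSplit 4 a`, `A 0 := ghA0 a`, `A 1 := ghA1 a`, `δ := ghDelta a = δ_u(4,a)/16`.
HONEST SCOPE.  (i) Rows `h2`/`d2` (MIXED SECOND DIFFERENCES) ARE NOT PROVED: the interior estimate has no second-difference leg (third differences of
`latticeGreen` are not in lit1's library — the gap `TransportLeg` records), and part 1's representation needs a mixed second difference of the block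
column, again one order short; heuristically the mixed second difference of the potential of a cube indicator is `log`-singular at the cube's edges, so
`h2` AS TYPED (`D₂/n⁴`, n-uniform) may fail for this leg by `log n` — a QUESTION for the row's owner, not an assertion.  (ii) `d = 4` only here (parts 1–2:
`d ≥ 3`).  (iii) Constants existential (`cI`, `cG0`, `cG1`), useless for numerics.
-/

namespace Summit.QuantumFields.BalabanUV.Beta.D1BFx.GhostLegFree

open Finset Real
open Literature.MathematicalPhysics.QuantumFieldTheory.Balaban1983to89
open Literature.MathematicalPhysics.QuantumFieldTheory.Balaban1983to89.Beta
open B6QGQLower276 (X e blk B mem_B side side_facts side_mul_blk_add_loc loc loc_nonneg loc_le)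
open B6QGQDecay237 (deltaU deltaU_pos deltaU_le_one)
open B5Hk103ScalarZd (Gk)
open Beta.PoissonInterior (nrm one_le_nrm nrm_pos supNorm_le_nrm natAbs_le_supNorm exists_natAbs_eq_supNorm supNorm_eq_zero_iff
  G₀ G₀_diff_bound)
open DyadicShell (Pt supNorm)
open BubbleTransfer (unitVec)
open GhostTable (gFree)
open GhostLeg (Ggh Ggh_apply cast_pred_add_one)
open PointColumnSplit (cG0 cG0_nonneg abs_G₀_le cSplit cSplit_nonneg abs_Gk_sub_free_le abs_Gk_diff_sub_free_le)
open PointColumnDecay (cFar cFar_pos abs_Gk_far_le abs_Gk_diff_far_le)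

noncomputable section

/-! ## §1 Dictionary: the wall's atoms are the lineage's atoms -/
/-- [folklore] `gFree = G₀` (both are `latticeGreen/2`). -/
theorem gFree_eq_G₀ (v : Pt) : gFree v = G₀ v := rfl

/-- [folklore] The wall's sup norm is lit1's (same formula on `Fin 4 → ℤ`). -/
theorem supNorm_eq (v : Pt) : supNorm v = Beta.PoissonInterior.supNorm v := rfl
/-- [folklore] The wall's unit vector is the lineage's `e ρ = Pi.single ρ 1`. -/
theorem unitVec_eq_e (ρ : Fin 4) : unitVec ρ = e ρ := rfl

/-- [folklore] For `v ≠ 0`, `nrm v = |v|_∞`. -/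
theorem nrm_eq_supNorm {v : Pt} (hv : v ≠ 0) : nrm v = (supNorm v : ℝ) := by
  have h1 : 1 ≤ Beta.PoissonInterior.supNorm v := by
    rw [Nat.one_le_iff_ne_zero]; exact fun h => hv (supNorm_eq_zero_iff.1 h)
  unfold nrm; rw [supNorm_eq, max_eq_right]; exact_mod_cast h1

/-- [our object] **The free leg's gradient envelope constant `C₁(4)`** (`PoissonInterior.G₀_diff_bound` at `d = 4`, chosen once). -/
def cG1 : ℝ := Classical.choose (G₀_diff_bound (d := 4) (by norm_num))

/-- [folklore] `cG1 ≥ 0` and the envelope `|G₀(v+e_ρ) − G₀ v| ≤ cG1/nrm v³`. -/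
theorem cG1_spec : 0 ≤ cG1 ∧ ∀ (v : Pt) (ρ : Fin 4), |G₀ (v + Pi.single ρ 1) - G₀ v| ≤ cG1 / nrm v ^ 3 := by
  have h := Classical.choose_spec (G₀_diff_bound (d := 4) (by norm_num))
  exact ⟨h.1, fun v ρ => (h.2 v ρ).1⟩

/-! ## §2 The near-field rows `h0`, `h1` -/

variable (n : ℕ) [NeZero n] {a : ℝ}

/-- [folklore] **ROW h0 FOR THE GHOST LEG**: `|n²·Ggh n a (b+v) b − gFree v| ≤ cSplit(4,a)/n²`, every `n ≥ 1`, `a > 0`, `b`, `v`. -/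
theorem ghost_h0 (ha : 0 < a) (b v : Pt) :
    |(n : ℝ) ^ 2 * Ggh n a (b + v) b () () - gFree v| ≤ cSplit 4 a / (n : ℝ) ^ 2 := by
  have hn : (0 : ℝ) < n := by exact_mod_cast Nat.pos_of_ne_zero (NeZero.ne n)
  have h := abs_Gk_sub_free_le (d := 4) (by norm_num) (n - 1) ha (b + v) b
  rw [cast_pred_add_one n, add_sub_cancel_left] at h
  rw [Ggh_apply, gFree_eq_G₀]
  have e1 : (n : ℝ) ^ 2 * Gk (n - 1) a (b + v) b - G₀ v = (n : ℝ) ^ 2 * (Gk (n - 1) a (b + v) b - G₀ v / (n : ℝ) ^ 2) := by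
    field_simp
  rw [e1, abs_mul, abs_of_pos (by positivity)]
  calc (n : ℝ) ^ 2 * |Gk (n - 1) a (b + v) b - G₀ v / (n : ℝ) ^ 2| ≤ (n : ℝ) ^ 2 * (cSplit 4 a / (n : ℝ) ^ 4) :=
        mul_le_mul_of_nonneg_left h (by positivity)
    _ = cSplit 4 a / (n : ℝ) ^ 2 := by field_simp

/-- [folklore] **ROW h1 FOR THE GHOST LEG**: `|(n²·Ggh(b+v+e_ρ) b − gFree(v+e_ρ)) − (n²·Ggh(b+v) b − gFree v)| ≤ cSplit(4,a)/n³`. -/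
theorem ghost_h1 (ha : 0 < a) (b v : Pt) (ρ : Fin 4) :
    |((n : ℝ) ^ 2 * Ggh n a (b + (v + unitVec ρ)) b () () - gFree (v + unitVec ρ))
        - ((n : ℝ) ^ 2 * Ggh n a (b + v) b () () - gFree v)| ≤ cSplit 4 a / (n : ℝ) ^ 3 := by
  have hn : (0 : ℝ) < n := by exact_mod_cast Nat.pos_of_ne_zero (NeZero.ne n)
  have h := abs_Gk_diff_sub_free_le (d := 4) (by norm_num) (n - 1) ha (b + v) b ρ
  rw [cast_pred_add_one n, add_sub_cancel_left, show b + v + e ρ - b = v + e ρ by abel] at h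
  rw [Ggh_apply, Ggh_apply, gFree_eq_G₀, gFree_eq_G₀, unitVec_eq_e, ← add_assoc]
  have e1 : ((n : ℝ) ^ 2 * Gk (n - 1) a (b + v + e ρ) b - G₀ (v + e ρ)) - ((n : ℝ) ^ 2 * Gk (n - 1) a (b + v) b - G₀ v)
      = (n : ℝ) ^ 2 * ((Gk (n - 1) a (b + v + e ρ) b - Gk (n - 1) a (b + v) b) - (G₀ (v + e ρ) - G₀ v) / (n : ℝ) ^ 2) := by
    field_simp; ring
  rw [e1, abs_mul, abs_of_pos (by positivity)]
  calc (n : ℝ) ^ 2 * |(Gk (n - 1) a (b + v + e ρ) b - Gk (n - 1) a (b + v) b) - (G₀ (v + e ρ) - G₀ v) / (n : ℝ) ^ 2|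
      ≤ (n : ℝ) ^ 2 * (cSplit 4 a / (n : ℝ) ^ (4 + 1)) := mul_le_mul_of_nonneg_left h (by positivity)
    _ = cSplit 4 a / (n : ℝ) ^ 3 := by field_simp; ring

/-! ## §3 The decay rows `d0`, `d1` -/

/-- [our object] **The ghost leg's decay rate** `ghDelta a = δ_u(4,a)/16` (per block of side `n`: the rows read `e^{−(δ/n)|v|_∞}`). -/
def ghDelta (a : ℝ) : ℝ := deltaU 4 a / 16

/-- [folklore] `ghDelta a > 0`. -/
theorem ghDelta_pos (ha : 0 < a) : 0 < ghDelta a := by unfold ghDelta; have := deltaU_pos 4 ha; positivity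

/-- [our object] **The d0 constant** `ghA0 a = (cG0 4 + 64·cSplit(4,a))·e + 256·cFar(4,a)·(2/δ_u)^4`. -/
def ghA0 (a : ℝ) : ℝ := (cG0 4 + 64 * cSplit 4 a) * Real.exp 1 + 256 * cFar 4 a * (2 / deltaU 4 a) ^ 4

/-- [our object] **The d1 constant** `ghA1 a = (cG1 + 512·cSplit(4,a))·e + 4096·cFar(4,a)·(2/δ_u)^5`. -/
def ghA1 (a : ℝ) : ℝ := (cG1 + 512 * cSplit 4 a) * Real.exp 1 + 4096 * cFar 4 a * (2 / deltaU 4 a) ^ 5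

/-- [folklore] A coordinate difference is controlled by the block offset: `|(p − q) i| ≤ (m+1)·|blk p i − blk q i| + m` (blocks of side `m+1`). -/
theorem natAbs_sub_le_blk (m : ℕ) (p q : Pt) (i : Fin 4) :
    (((p - q) i).natAbs : ℝ) ≤ ((m : ℝ) + 1) * ((blk m p i - blk m q i).natAbs : ℝ) + m := by
  have hp := side_mul_blk_add_loc m p i
  have hq := side_mul_blk_add_loc m q i
  have h1 := loc_nonneg m p i; have h2 := loc_le m p i
  have h3 := loc_nonneg m q i; have h4 := loc_le m q i
  have hside : side m = (m : ℤ) + 1 := rfl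
  have key : |(p - q) i| ≤ ((m : ℤ) + 1) * |blk m p i - blk m q i| + m := by
    have e1 : (p - q) i = side m * (blk m p i - blk m q i) + (loc m p i - loc m q i) := by
      simp only [Pi.sub_apply]; rw [← hp, ← hq]; ring
    rw [e1, hside]
    have hA : |((m : ℤ) + 1) * (blk m p i - blk m q i)| = ((m : ℤ) + 1) * |blk m p i - blk m q i| := by
      rw [abs_mul, abs_of_nonneg (by positivity : (0 : ℤ) ≤ (m : ℤ) + 1)]
    have hB : |loc m p i - loc m q i| ≤ m := by rw [abs_le]; constructor <;> linarith
    calc |((m : ℤ) + 1) * (blk m p i - blk m q i) + (loc m p i - loc m q i)|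
        ≤ |((m : ℤ) + 1) * (blk m p i - blk m q i)| + |loc m p i - loc m q i| := abs_add_le _ _
      _ ≤ ((m : ℤ) + 1) * |blk m p i - blk m q i| + m := by rw [hA]; linarith
  have e2 : (((p - q) i).natAbs : ℤ) = |(p - q) i| := Int.natCast_natAbs _
  have e3 : ((blk m p i - blk m q i).natAbs : ℤ) = |blk m p i - blk m q i| := Int.natCast_natAbs _
  have : (((p - q) i).natAbs : ℤ) ≤ ((m : ℤ) + 1) * ((blk m p i - blk m q i).natAbs : ℤ) + m := by rw [e2, e3]; exact key
  exact_mod_cast this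

/-- [folklore] Polynomial weights are absorbed by the exponential: `k^j·e^{−4δk} ≤ (2/δ)^j·e^{−δk}` for `k ≥ 0`, `0 < δ`, `j ≤ 5`
(from `x + 1 ≤ e^x` at `x = δk/2`). -/
theorem pow_mul_exp_le {δ k : ℝ} (hδ : 0 < δ) (hk : 0 ≤ k) {j : ℕ} (hj : j ≤ 5) :
    k ^ j * Real.exp (-(4 * δ * k)) ≤ (2 / δ) ^ j * Real.exp (-(δ * k)) := by
  have h1 : k ≤ 2 / δ * Real.exp (δ * k / 2) := by
    have h := Real.add_one_le_exp (δ * k / 2)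
    rw [div_mul_eq_mul_div, le_div_iff₀ hδ]
    nlinarith [Real.exp_pos (δ * k / 2)]
  have h2 : k ^ j ≤ (2 / δ) ^ j * Real.exp (δ * k / 2) ^ j := by
    rw [← mul_pow]; exact pow_le_pow_left₀ hk h1 j
  have h3 : Real.exp (δ * k / 2) ^ j ≤ Real.exp (3 * δ * k) := by
    rw [← Real.exp_nat_mul]
    apply Real.exp_le_exp.2
    have hj' : (j : ℝ) ≤ 5 := by exact_mod_cast hj
    have hδk : 0 ≤ δ * k := mul_nonneg hδ.le hk
    nlinarith [mul_nonneg (sub_nonneg.2 hj') hδk]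
  have h4 : 3 * δ * k + -(4 * δ * k) = -(δ * k) := by ring
  calc k ^ j * Real.exp (-(4 * δ * k)) ≤ ((2 / δ) ^ j * Real.exp (3 * δ * k)) * Real.exp (-(4 * δ * k)) := by
        refine mul_le_mul_of_nonneg_right (h2.trans ?_) (Real.exp_pos _).le
        exact mul_le_mul_of_nonneg_left h3 (by positivity)
    _ = (2 / δ) ^ j * Real.exp (-(δ * k)) := by rw [mul_assoc, ← Real.exp_add, h4]

set_option maxHeartbeats 400000 in
/-- [folklore] **THE DECAY ROWS d0 AND d1 FOR THE GHOST LEG** (joint statement; one case analysis near/far). -/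
theorem ghost_decay_legs (ha : 0 < a) (b v : Pt) (hv : v ≠ 0) :
    |(n : ℝ) ^ 2 * Ggh n a (b + v) b () ()| ≤ ghA0 a * Real.exp (-(ghDelta a / n) * supNorm v) / (supNorm v : ℝ) ^ 2 ∧
    ∀ ρ : Fin 4, |(n : ℝ) ^ 2 * Ggh n a (b + (v + unitVec ρ)) b () () - (n : ℝ) ^ 2 * Ggh n a (b + v) b () ()|
      ≤ ghA1 a * Real.exp (-(ghDelta a / n) * supNorm v) / (supNorm v : ℝ) ^ 3 := by
  have hn : (0 : ℝ) < n := by exact_mod_cast Nat.pos_of_ne_zero (NeZero.ne n)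
  set m : ℕ := n - 1 with hm
  have hmn : ((m : ℝ) + 1) = n := cast_pred_add_one n
  set δ := deltaU 4 a with hδ
  have hδ0 : 0 < δ := deltaU_pos 4 ha
  have hδ1 : δ ≤ 1 := deltaU_le_one 4 a
  set N : ℝ := (supNorm v : ℝ) with hN
  have hN1 : 1 ≤ N := by
    have : 1 ≤ Beta.PoissonInterior.supNorm v := by
      rw [Nat.one_le_iff_ne_zero]; exact fun h => hv (supNorm_eq_zero_iff.1 h)
    rw [hN, supNorm_eq]; exact_mod_cast this
  have hN0 : 0 < N := by linarith
  have hnrm : nrm v = N := by rw [hN]; exact nrm_eq_supNorm hv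
  -- the coordinate achieving `|v|_∞` and the block offset `K₀` along it
  obtain ⟨i₀, hi₀⟩ := exists_natAbs_eq_supNorm (by norm_num : 0 < 4) v
  set K₀ : ℕ := (blk m (b + v) i₀ - blk m b i₀).natAbs with hK₀
  have hNK : N ≤ (n : ℝ) * K₀ + m := by
    have h := natAbs_sub_le_blk m (b + v) b i₀
    rw [add_sub_cancel_left, hi₀, hmn] at h
    rw [hN, supNorm_eq]; exact h
  have hmle : (m : ℝ) ≤ n - 1 := by
    have : (m : ℝ) + 1 = n := hmn
    linarith
  have hK₀dist : (K₀ : ℝ) ≤ dist (blk m (b + v)) (blk m b) := by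
    have h := dist_le_pi_dist (blk m (b + v)) (blk m b) i₀
    rw [Int.dist_eq] at h
    have e : (K₀ : ℝ) = |((blk m (b + v) i₀ : ℤ) : ℝ) - ((blk m b i₀ : ℤ) : ℝ)| := by
      rw [hK₀, Nat.cast_natAbs, Int.cast_abs, Int.cast_sub]
    rw [e]; exact h
  -- constants
  have hcG0 := cG0_nonneg 4
  obtain ⟨hcG1, hG1⟩ := cG1_spec
  have hcS := cSplit_nonneg 4 ha
  have hcF := cFar_pos 4 ha
  have he1 : (1 : ℝ) ≤ Real.exp 1 := Real.one_le_exp zero_le_one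
  set Eδ := Real.exp (-(ghDelta a / n) * N) with hEδ
  have hEδ0 : 0 < Eδ := Real.exp_pos _
  have hA0a : (cG0 4 + 64 * cSplit 4 a) * Real.exp 1 ≤ ghA0 a := by
    unfold ghA0; have : 0 ≤ 256 * cFar 4 a * (2 / deltaU 4 a) ^ 4 := by positivity
    linarith
  have hA0b : 256 * cFar 4 a * (2 / δ) ^ 4 ≤ ghA0 a := by
    unfold ghA0; rw [← hδ]; have : 0 ≤ (cG0 4 + 64 * cSplit 4 a) * Real.exp 1 := by positivity
    linarith
  have hA1a : (cG1 + 512 * cSplit 4 a) * Real.exp 1 ≤ ghA1 a := by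
    unfold ghA1; have : 0 ≤ 4096 * cFar 4 a * (2 / deltaU 4 a) ^ 5 := by positivity
    linarith
  have hA1b : 4096 * cFar 4 a * (2 / δ) ^ 5 ≤ ghA1 a := by
    unfold ghA1; rw [← hδ]; have : 0 ≤ (cG1 + 512 * cSplit 4 a) * Real.exp 1 := by positivity
    linarith
  -- the two values in the leg's units
  have hval : (n : ℝ) ^ 2 * Ggh n a (b + v) b () () = (n : ℝ) ^ 2 * Gk m a (b + v) b := by rw [Ggh_apply]
  have hdif : ∀ ρ : Fin 4, (n : ℝ) ^ 2 * Ggh n a (b + (v + unitVec ρ)) b () () - (n : ℝ) ^ 2 * Ggh n a (b + v) b () ()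
      = (n : ℝ) ^ 2 * (Gk m a (b + v + e ρ) b - Gk m a (b + v) b) := by
    intro ρ; rw [Ggh_apply, Ggh_apply, unitVec_eq_e, ← add_assoc]; ring
  by_cases hfar : 8 ≤ K₀
  · -- FAR FIELD: `k = K₀/8 ≥ 1`, `8k ≤ K₀ ≤ dist (blk (b+v)) (blk b)`, `N ≤ 16kn`
    set k : ℕ := K₀ / 8 with hk
    have hk1 : 1 ≤ k := by omega
    have hk8 : 8 * k ≤ K₀ := by omega
    have hK16 : K₀ + 1 ≤ 16 * k := by omega
    have hkR : (1 : ℝ) ≤ k := by exact_mod_cast hk1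
    have hk0 : (0 : ℝ) ≤ k := by positivity
    have h8k : 8 * (k : ℝ) ≤ dist (blk m (b + v)) (blk m b) := le_trans (by exact_mod_cast hk8) hK₀dist
    have hN16 : N ≤ 16 * k * n := by
      have h16 : (K₀ : ℝ) + 1 ≤ 16 * k := by exact_mod_cast hK16
      nlinarith
    -- the exponential: `e^{−δk} ≤ e^{−(δ/16n)N}`
    have hexp : Real.exp (-(δ * k)) ≤ Eδ := by
      rw [hEδ]; apply Real.exp_le_exp.2
      unfold ghDelta; rw [← hδ]
      have : δ / 16 / n * N ≤ δ * k := by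
        rw [div_div, div_mul_eq_mul_div, div_le_iff₀ (by positivity)]; nlinarith
      linarith
    have hfarV := abs_Gk_far_le (d := 4) (by norm_num) m ha (b + v) b hk1 h8k
    have hfarD := fun ρ => abs_Gk_diff_far_le (d := 4) (by norm_num) m ha (b + v) b hk1 h8k ρ
    rw [hmn] at hfarV
    constructor
    · rw [hval, abs_mul, abs_of_pos (by positivity)]
      -- `n² · cFar k²/n⁴ e^{−4δk} ≤ 256 cFar k⁴ e^{−4δk}/N² ≤ 256 cFar (2/δ)^4 e^{−δk}/N²`
      have h1 : (n : ℝ) ^ 2 * (cFar 4 a * (k : ℝ) ^ 2 / (n : ℝ) ^ 4 * Real.exp (-(4 * δ * k)))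
          = cFar 4 a * ((k : ℝ) ^ 2 * Real.exp (-(4 * δ * k))) / (n : ℝ) ^ 2 := by field_simp
      have h2 : 1 / (n : ℝ) ^ 2 ≤ 256 * (k : ℝ) ^ 2 / N ^ 2 := by
        rw [div_le_div_iff₀ (by positivity) (by positivity), one_mul]
        calc N ^ 2 ≤ (16 * k * n) ^ 2 := pow_le_pow_left₀ hN0.le hN16 2
          _ = 256 * (k : ℝ) ^ 2 * (n : ℝ) ^ 2 := by ring
      have h3 : (k : ℝ) ^ 4 * Real.exp (-(4 * δ * k)) ≤ (2 / δ) ^ 4 * Real.exp (-(δ * k)) := pow_mul_exp_le hδ0 hk0 (by norm_num)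
      calc (n : ℝ) ^ 2 * |Gk m a (b + v) b| ≤ (n : ℝ) ^ 2 * (cFar 4 a * (k : ℝ) ^ 2 / (n : ℝ) ^ 4 * Real.exp (-(4 * δ * k))) :=
            mul_le_mul_of_nonneg_left (by rw [hδ]; exact hfarV) (by positivity)
        _ = cFar 4 a * ((k : ℝ) ^ 2 * Real.exp (-(4 * δ * k))) * (1 / (n : ℝ) ^ 2) := by rw [h1]; ring
        _ ≤ cFar 4 a * ((k : ℝ) ^ 2 * Real.exp (-(4 * δ * k))) * (256 * (k : ℝ) ^ 2 / N ^ 2) :=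
            mul_le_mul_of_nonneg_left h2 (by positivity)
        _ = 256 * cFar 4 a * ((k : ℝ) ^ 4 * Real.exp (-(4 * δ * k))) / N ^ 2 := by ring
        _ ≤ 256 * cFar 4 a * ((2 / δ) ^ 4 * Real.exp (-(δ * k))) / N ^ 2 := by gcongr
        _ ≤ 256 * cFar 4 a * ((2 / δ) ^ 4 * Eδ) / N ^ 2 := by gcongr
        _ = (256 * cFar 4 a * (2 / δ) ^ 4) * Eδ / N ^ 2 := by ring
        _ ≤ ghA0 a * Eδ / N ^ 2 := by gcongr
    · intro ρ
      rw [hdif ρ, abs_mul, abs_of_pos (by positivity)]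
      have hD := hfarD ρ
      rw [hmn] at hD
      have h1 : (n : ℝ) ^ 2 * (cFar 4 a * (k : ℝ) ^ 2 / (n : ℝ) ^ (4 + 1) * Real.exp (-(4 * δ * k)))
          = cFar 4 a * ((k : ℝ) ^ 2 * Real.exp (-(4 * δ * k))) / (n : ℝ) ^ 3 := by field_simp
      have h2 : 1 / (n : ℝ) ^ 3 ≤ 4096 * (k : ℝ) ^ 3 / N ^ 3 := by
        rw [div_le_div_iff₀ (by positivity) (by positivity), one_mul]
        calc N ^ 3 ≤ (16 * k * n) ^ 3 := pow_le_pow_left₀ hN0.le hN16 3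
          _ = 4096 * (k : ℝ) ^ 3 * (n : ℝ) ^ 3 := by ring
      have h3 : (k : ℝ) ^ 5 * Real.exp (-(4 * δ * k)) ≤ (2 / δ) ^ 5 * Real.exp (-(δ * k)) := pow_mul_exp_le hδ0 hk0 le_rfl
      calc (n : ℝ) ^ 2 * |Gk m a (b + v + e ρ) b - Gk m a (b + v) b|
          ≤ (n : ℝ) ^ 2 * (cFar 4 a * (k : ℝ) ^ 2 / (n : ℝ) ^ (4 + 1) * Real.exp (-(4 * δ * k))) :=
            mul_le_mul_of_nonneg_left (by rw [hδ]; exact hD) (by positivity)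
        _ = cFar 4 a * ((k : ℝ) ^ 2 * Real.exp (-(4 * δ * k))) * (1 / (n : ℝ) ^ 3) := by rw [h1]; ring
        _ ≤ cFar 4 a * ((k : ℝ) ^ 2 * Real.exp (-(4 * δ * k))) * (4096 * (k : ℝ) ^ 3 / N ^ 3) :=
            mul_le_mul_of_nonneg_left h2 (by positivity)
        _ = 4096 * cFar 4 a * ((k : ℝ) ^ 5 * Real.exp (-(4 * δ * k))) / N ^ 3 := by ring
        _ ≤ 4096 * cFar 4 a * ((2 / δ) ^ 5 * Real.exp (-(δ * k))) / N ^ 3 := by gcongr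
        _ ≤ 4096 * cFar 4 a * ((2 / δ) ^ 5 * Eδ) / N ^ 3 := by gcongr
        _ = (4096 * cFar 4 a * (2 / δ) ^ 5) * Eδ / N ^ 3 := by ring
        _ ≤ ghA1 a * Eδ / N ^ 3 := by gcongr
  · -- NEAR FIELD: `K₀ ≤ 7`, so `N ≤ 8n − 1 < 8n`; the split bound + the free-leg envelopes
    rw [not_le] at hfar
    have hK7 : (K₀ : ℝ) ≤ 7 := by exact_mod_cast (show K₀ ≤ 7 by omega)
    have hN8 : N ≤ 8 * n := by nlinarith
    -- the exponential: `1 ≤ e · e^{−(δ/16n)N}` since `(δ/16n)N ≤ δ/2 ≤ 1`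
    have hexp : 1 ≤ Real.exp 1 * Eδ := by
      rw [hEδ, ← Real.exp_add]; apply Real.one_le_exp
      unfold ghDelta; rw [← hδ]
      have : δ / 16 / n * N ≤ δ / 2 := by
        rw [div_div, div_mul_eq_mul_div, div_le_iff₀ (by positivity)]; nlinarith
      linarith
    have hsplit := abs_Gk_sub_free_le (d := 4) (by norm_num) m ha (b + v) b
    rw [hmn, add_sub_cancel_left] at hsplit
    constructor
    · rw [hval]
      -- `|n² Gk| ≤ |G₀ v| + cSplit/n² ≤ cG0/N² + 64 cSplit/N²`
      have h1 : |(n : ℝ) ^ 2 * Gk m a (b + v) b| ≤ |G₀ v| + cSplit 4 a / (n : ℝ) ^ 2 := by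
        have e1 : (n : ℝ) ^ 2 * Gk m a (b + v) b = (n : ℝ) ^ 2 * (Gk m a (b + v) b - G₀ v / (n : ℝ) ^ 2) + G₀ v := by
          field_simp; ring
        rw [e1]
        refine (abs_add_le _ _).trans ?_
        rw [abs_mul, abs_of_pos (by positivity), add_comm]
        gcongr
        calc (n : ℝ) ^ 2 * |Gk m a (b + v) b - G₀ v / (n : ℝ) ^ 2| ≤ (n : ℝ) ^ 2 * (cSplit 4 a / (n : ℝ) ^ 4) :=
              mul_le_mul_of_nonneg_left hsplit (by positivity)
          _ = cSplit 4 a / (n : ℝ) ^ 2 := by field_simp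
      have h2 : |G₀ v| ≤ cG0 4 / N ^ 2 := by
        have h := abs_G₀_le (d := 4) (by norm_num) v
        rw [hnrm] at h; exact h
      have h3 : cSplit 4 a / (n : ℝ) ^ 2 ≤ 64 * cSplit 4 a / N ^ 2 := by
        rw [div_le_div_iff₀ (by positivity) (by positivity)]
        have : N ^ 2 ≤ (8 * n) ^ 2 := pow_le_pow_left₀ hN0.le hN8 2
        calc cSplit 4 a * N ^ 2 ≤ cSplit 4 a * (8 * n) ^ 2 := mul_le_mul_of_nonneg_left this hcS
          _ = 64 * cSplit 4 a * (n : ℝ) ^ 2 := by ring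
      calc |(n : ℝ) ^ 2 * Gk m a (b + v) b| ≤ cG0 4 / N ^ 2 + 64 * cSplit 4 a / N ^ 2 := h1.trans (add_le_add h2 h3)
        _ = (cG0 4 + 64 * cSplit 4 a) * 1 / N ^ 2 := by ring
        _ ≤ (cG0 4 + 64 * cSplit 4 a) * (Real.exp 1 * Eδ) / N ^ 2 := by gcongr
        _ = ((cG0 4 + 64 * cSplit 4 a) * Real.exp 1) * Eδ / N ^ 2 := by ring
        _ ≤ ghA0 a * Eδ / N ^ 2 := by gcongr
    · intro ρ
      rw [hdif ρ]
      have hsd := abs_Gk_diff_sub_free_le (d := 4) (by norm_num) m ha (b + v) b ρ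
      rw [hmn, add_sub_cancel_left, show b + v + e ρ - b = v + e ρ by abel] at hsd
      have h1 : |(n : ℝ) ^ 2 * (Gk m a (b + v + e ρ) b - Gk m a (b + v) b)| ≤ |G₀ (v + e ρ) - G₀ v| + cSplit 4 a / (n : ℝ) ^ 3 := by
        have e1 : (n : ℝ) ^ 2 * (Gk m a (b + v + e ρ) b - Gk m a (b + v) b)
            = (n : ℝ) ^ 2 * ((Gk m a (b + v + e ρ) b - Gk m a (b + v) b) - (G₀ (v + e ρ) - G₀ v) / (n : ℝ) ^ 2)
              + (G₀ (v + e ρ) - G₀ v) := by field_simp; ring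
        rw [e1]
        refine (abs_add_le _ _).trans ?_
        rw [abs_mul, abs_of_pos (by positivity), add_comm]
        gcongr
        calc (n : ℝ) ^ 2 * |(Gk m a (b + v + e ρ) b - Gk m a (b + v) b) - (G₀ (v + e ρ) - G₀ v) / (n : ℝ) ^ 2|
            ≤ (n : ℝ) ^ 2 * (cSplit 4 a / (n : ℝ) ^ (4 + 1)) := mul_le_mul_of_nonneg_left hsd (by positivity)
          _ = cSplit 4 a / (n : ℝ) ^ 3 := by field_simp; ring
      have h2 : |G₀ (v + e ρ) - G₀ v| ≤ cG1 / N ^ 3 := by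
        have h := hG1 v ρ
        rw [hnrm] at h; exact h
      have h3 : cSplit 4 a / (n : ℝ) ^ 3 ≤ 512 * cSplit 4 a / N ^ 3 := by
        rw [div_le_div_iff₀ (by positivity) (by positivity)]
        have : N ^ 3 ≤ (8 * n) ^ 3 := pow_le_pow_left₀ hN0.le hN8 3
        calc cSplit 4 a * N ^ 3 ≤ cSplit 4 a * (8 * n) ^ 3 := mul_le_mul_of_nonneg_left this hcS
          _ = 512 * cSplit 4 a * (n : ℝ) ^ 3 := by ring
      calc |(n : ℝ) ^ 2 * (Gk m a (b + v + e ρ) b - Gk m a (b + v) b)| ≤ cG1 / N ^ 3 + 512 * cSplit 4 a / N ^ 3 :=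
            h1.trans (add_le_add h2 h3)
        _ = (cG1 + 512 * cSplit 4 a) * 1 / N ^ 3 := by ring
        _ ≤ (cG1 + 512 * cSplit 4 a) * (Real.exp 1 * Eδ) / N ^ 3 := by gcongr
        _ = ((cG1 + 512 * cSplit 4 a) * Real.exp 1) * Eδ / N ^ 3 := by ring
        _ ≤ ghA1 a * Eδ / N ^ 3 := by gcongr

/-- [folklore] **ROW d0 FOR THE GHOST LEG**: `|n²·Ggh n a (b+v) b| ≤ ghA0(a)·e^{−(ghDelta a/n)·|v|_∞}/|v|_∞²` for `v ≠ 0`. -/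
theorem ghost_d0 (ha : 0 < a) (b v : Pt) (hv : v ≠ 0) :
    |(n : ℝ) ^ 2 * Ggh n a (b + v) b () ()| ≤ ghA0 a * Real.exp (-(ghDelta a / n) * supNorm v) / (supNorm v : ℝ) ^ 2 :=
  (ghost_decay_legs n ha b v hv).1

/-- [folklore] **ROW d1 FOR THE GHOST LEG**: `|n²·Ggh(b+v+e_ρ) b − n²·Ggh(b+v) b| ≤ ghA1(a)·e^{−(ghDelta a/n)·|v|_∞}/|v|_∞³` for `v ≠ 0`. -/
theorem ghost_d1 (ha : 0 < a) (b v : Pt) (hv : v ≠ 0) (ρ : Fin 4) :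
    |(n : ℝ) ^ 2 * Ggh n a (b + (v + unitVec ρ)) b () () - (n : ℝ) ^ 2 * Ggh n a (b + v) b () ()|
      ≤ ghA1 a * Real.exp (-(ghDelta a / n) * supNorm v) / (supNorm v : ℝ) ^ 3 :=
  (ghost_decay_legs n ha b v hv).2 ρ

/-! ## §4 The rows in A2′'s binder shapes, for the leg family `G := fun v => n²·Ggh n a (b+v) b` -/
/-- [our object] **The ghost leg's displacement function at base point `b`, in the wall's units** (`× n²`, free part `gFree`). -/
def ghLeg (a : ℝ) (b : Pt) : Pt → ℝ := fun v => (n : ℝ) ^ 2 * Ggh n a (b + v) b () ()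

variable {n} in
/-- [folklore] The four rows `h0 h1 d0 d1` of `GhostRelegging.abs_fullSum_stKI_sub_le` / `SquareTable.oneLoopDrift_of_scalarBounds_avg`
for `G := ghLeg n a b`, with `D 0 = D 1 = cSplit 4 a`, `A 0 = ghA0 a`, `A 1 = ghA1 a`, `δ = ghDelta a` — every `n ≥ 1`, every base point. -/
theorem ghLeg_rows (ha : 0 < a) (b : Pt) :
    (∀ v, |ghLeg n a b v - gFree v| ≤ cSplit 4 a / (n : ℝ) ^ 2) ∧
    (∀ v (ρ : Fin 4), |(ghLeg n a b (v + unitVec ρ) - gFree (v + unitVec ρ)) - (ghLeg n a b v - gFree v)|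
        ≤ cSplit 4 a / (n : ℝ) ^ 3) ∧
    (∀ v : Pt, v ≠ 0 → |ghLeg n a b v| ≤ ghA0 a * Real.exp (-(ghDelta a / n) * supNorm v) / (supNorm v : ℝ) ^ 2) ∧
    (∀ v : Pt, v ≠ 0 → ∀ ρ : Fin 4, |ghLeg n a b (v + unitVec ρ) - ghLeg n a b v|
        ≤ ghA1 a * Real.exp (-(ghDelta a / n) * supNorm v) / (supNorm v : ℝ) ^ 3) :=
  ⟨fun v => ghost_h0 n ha b v, fun v ρ => ghost_h1 n ha b v ρ, fun v hv => ghost_d0 n ha b v hv,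
    fun v hv ρ => ghost_d1 n ha b v hv ρ⟩

end

end Summit.QuantumFields.BalabanUV.Beta.D1BFx.GhostLegFree
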